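import Literature.CategoryTheory.Abelian.SocleRadicalLoewyLength
import Literature.Order.ModularLattice.LoewyLengthIntervals
import HarnessLib

/-!
# The Loewy length of subobjects, quotients, extensions and sums; `socᵏ(K) = K ∩ socᵏ(X)`, `radᵏ(X∕K) = (K + radᵏX)∕K`; the height as the
# length of the shortest filtration with semisimple layers (objects of finite length of an abelian category)

Topic `Literature/CategoryTheory/Abelian`, namespace `Literature.CategoryTheory.KrullSchmidt`.  Thirteenth file of the CHAIN-CONDITIONS
story (g42-#4): the object-level corollaries of `Order/ModularLattice/LoewyLengthIntervals` (g42-#3) for the socle ∕ radical series and the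
height = Loewy length of `SocleRadicalLoewyLength` (g42-#2), transported along `Subobject (K : C) ≃o [⊥, K]` (Mathlib `subobjectOrderIso`)
and `Subobject (X ∕ K) ≃o [K, ⊤]` (g41-#10 `pullbackOrderIsoIci`).  Krause's glossary defines `socⁿ`, `radⁿ`, the height `ht` and the Loewy
length; §11.2 states `ht(X) ≤ ℓ(X)` and height = Loewy length for `ℓ(X) < ∞` (g42-#2).  Here the standard inequalities that make the Loewy
length usable: **`ℓℓ(K) ≤ ℓℓ(X)`, `ℓℓ(X∕K) ≤ ℓℓ(X)`, `ℓℓ(X) ≤ ℓℓ(K) + ℓℓ(X∕K)`** (also along monos ∕ epis ∕ short exact sequences),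
**`ℓℓ(X ⊞ Y) = max`**, `ht(socⁿ X) = n`, `ℓℓ(X ∕ socⁿX) = ht(X) − n`, the series of subobjects and quotients (`socᵏ(K) = K ∩ socᵏ(X)`,
`radᵏ(X∕K) = (K + radᵏ X)∕K`, `q(socᵏ X) ⊆ socᵏ(X∕K)`, `radᵏ(K) ⊆ radᵏ(X)`), and **the height as the minimal length of a filtration with
semisimple layers** (§3), with `ℓℓ(X) ≤ 2 ↔ rad(X) ⊆ soc(X)`.  Everything proved; no definition, no named fact, no instance, no notation.
Instance hypotheses on subobjects ∕ quotients (`[IsNoetherianObject (K : C)]`, `[IsArtinianObject (cokernel K.arrow)]`, …) are to be supplied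
by the caller from g41-#8 (`isNoetherianObject_of_mono`, `isArtinianObject_of_epi`), as in g42-#2.

## The sources

Krause [Krause2021, Glossary «Socle», «Radical» (PDF p. 21); §11.2 (PDF p. 358)] (quoted in g42-#2).  The inequalities are the routine
consequences recorded for modules of finite length in the module literature (the tree's `Algebra/Module/LoewyLengthExtensions`,
`LoewySeriesIterate` after [BerrickKeating2000, §4.1.13–4.1.18]); the proofs are the lattice statements of g42-#3
([NastasescuVanoystaeyen1987, Ch. 1 §§1.8–1.9]) read through the two order isomorphisms.

## What is formalised (`C` abelian, `X : C` of finite length)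

* §1 **`map_socleSeries_eq_inf : K(socᵏ K) = K ⊓ socᵏ(X)`**, **`pullback_radicalSeries_eq_sup : q⁻¹(radᵏ(X∕K)) = K ⊔ radᵏ(X)`**,
  `imageSubobject_socleSeries_arrow_comp_le` (`q(socᵏ X) ≤ socᵏ(X∕K)`), `map_radicalSeries_le` (`radᵏ(K) ≤ radᵏ(X)`).
* §2 `height_subobject_eq` (`ht(K) = Λ([⊥,K])`), `loewyLength_cokernel_eq` (`ℓℓ(X∕K) = ll([K,⊤])`), `loewyLength_eq_of_epi`,
  **`height_subobject_le`**, **`height_le_of_mono`**, **`loewyLength_le_of_epi`**, `loewyLength_le_of_mono`, `height_le_of_epi`,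
  **`loewyLength_le_add : ℓℓ(X) ≤ ℓℓ(K) + ℓℓ(X∕K)`**, **`loewyLength_le_add_of_shortExact`**, `mk_inl_sup_mk_inr`, **`height_biprod`**,
  **`loewyLength_biprod`** (`= max`), **`height_socleSeries : ht(socⁿX) = n`**, **`loewyLength_cokernel_socleSeries : ℓℓ(X∕socⁿX) = ht(X) − n`**.
* §3 **`le_socleSeries_of_isSemisimpleObj_layers`** (a filtration from `0` with semisimple layers lies under the socle series),
  `radicalSeries_le_of_isSemisimpleObj_layers` (dually over the radical series), **`height_le_of_isSemisimpleObj_layers`**,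
  `loewyLength_le_of_isSemisimpleObj_layers` (the height ∕ Loewy length is the minimal length of such a filtration),
  **`loewyLength_le_two_iff : ℓℓ(X) ≤ 2 ↔ rad(X) ≤ soc(X)`**.

## Mathlib ∕ Literature search

Mathlib: `Subobject.subobjectOrderIso`, `Subobject.underlyingIso`, `Subobject.mk_factors_self`, `Subobject.factors_of_factors_right`,
`Subobject.eq_top_of_isIso_arrow`, `isIso_of_mono_of_isSplitEpi`, `biprod.total`, `OrderIso.setCongr`, `GaloisCoinsertion.l_injective`.
Literature REUSED: g42-#3 (`coe_socleSeries_Iic`, `coe_radicalSeries_Ici`, `socleLength_Iic_le`, `radicalLength_Ici_le`, `radicalLength_le_add`,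
`socleLength_eq_max_of_sup_eq_top`, `socleLength_Iic_socleSeries`, `socleLength_Ici_socleSeries`, `socleSeries_le_iterate_socleAbove`,
`iterate_radicalBelow_le_radicalSeries`), g42-#2 (`socleSeries`, `radicalSeries`, `height`, `loewyLength`, `height_eq_loewyLength`, `height_eq_of_iso`,
`le_socleSeries_succ_of_isSemisimpleObj`, `radicalSeries_succ_le_of_isSemisimpleObj`, `radicalSeries_succ_eq_map_radical`, `le_socle_iff_isSemisimpleObj`,
`radical_eq_bot_iff`, `subobjectOrderIso_apply_coe`), g42-#1 (`map_socleSeries`, `map_radicalSeries`, `socleLength_eq_of_orderIso`,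
`radicalLength_eq_of_orderIso`, `socleLength_eq_radicalLength`), g41-#10 (`pullbackOrderIsoIci`, `kernelSubobject_cokernel_π_arrow`), g41-#8
(`isNoetherianObject_of_mono`, `isArtinianObject_of_epi`, `nonempty_cokernel_mk_arrow_iso`, `gc_imageSubobject_pullback`, `gciMapPullback`),
g41-#7 (`isModularLattice_subobject`, `sup_factors_add`).

## References

* H. Krause, *Homological Theory of Representations*, CUP (2021): Glossary «Socle», «Radical» (PDF p. 21); §11.2 (PDF p. 358). [Krause2021]
* C. Năstăsescu, F. Van Oystaeyen, *Dimensions of Ring Theory*, D. Reidel (1987): Ch. 1 §§1.8–1.9. [NastasescuVanoystaeyen1987]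
* A. J. Berrick, M. E. Keating, *An Introduction to Rings and Modules*, CUP (2000): §4.1.13–4.1.18 (module versions). [BerrickKeating2000]

## Provenance

Lane `lit-hodgefound` (summit `HodgeConjecture`, Track 2 foundations library), seat `lit-hodgefound-p36` (literature-prover, generation 42,
row g42-#4).
-/

open CategoryTheory CategoryTheory.Limits
open Literature.Order.ModularLattice hiding socleSeries radicalSeries socleLength radicalLength

namespace Literature.CategoryTheory.KrullSchmidt

universe v u

variable {C : Type u} [Category.{v} C] [Abelian C] {X : C}

/-! ## §1 The socle series of a subobject and the radical series of a quotient -/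

section Series

/-- **`socᵏ(K) = K ∩ socᵏ(X)`** for a subobject `K ⊆ X` of an object of finite length (as subobjects of `X`). [cite: Krause2021, Glossary «Socle», «Radical» (PDF p. 21)] -/
theorem map_socleSeries_eq_inf (K : Subobject X) [IsNoetherianObject (K : C)] [IsNoetherianObject X] [IsArtinianObject X] (k : ℕ) :
    (Subobject.map K.arrow).obj (socleSeries (K : C) k) = K ⊓ socleSeries X k := by
  haveI := isModularLattice_subobject X
  rw [← subobjectOrderIso_apply_coe, socleSeries_def, Order.ModularLattice.map_socleSeries (Subobject.subobjectOrderIso K) k,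
    coe_socleSeries_Iic]
  rfl

/-- **`q⁻¹(radᵏ(X ∕ K)) = K + radᵏ(X)`**, i.e. `radᵏ(X ∕ K) = (K + radᵏ X) ∕ K`, for a subobject `K` of an object of finite length. [cite: Krause2021, Glossary «Socle», «Radical» (PDF p. 21)] -/
theorem pullback_radicalSeries_eq_sup (K : Subobject X) [IsArtinianObject (cokernel K.arrow)] [IsNoetherianObject X] [IsArtinianObject X]
    (k : ℕ) : (Subobject.pullback (cokernel.π K.arrow)).obj (radicalSeries (cokernel K.arrow) k) = K ⊔ radicalSeries X k := by
  haveI := isModularLattice_subobject X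
  rw [← pullbackOrderIsoIci_apply_coe (cokernel.π K.arrow), radicalSeries_def (X := cokernel K.arrow),
    Order.ModularLattice.map_radicalSeries (pullbackOrderIsoIci (cokernel.π K.arrow)) k, coe_radicalSeries_Ici,
    kernelSubobject_cokernel_π_arrow]
  rfl

/-- The socle series of `X`, pushed into the quotient `X ∕ K`, lies in the socle series of the quotient: `q(socᵏ X) ⊆ socᵏ(X ∕ K)`. [cite: Krause2021, Glossary «Socle», «Radical» (PDF p. 21)] -/
theorem imageSubobject_socleSeries_arrow_comp_le (K : Subobject X) [IsNoetherianObject (cokernel K.arrow)] [IsNoetherianObject X]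
    [IsArtinianObject X] (k : ℕ) : imageSubobject ((socleSeries X k).arrow ≫ cokernel.π K.arrow) ≤ socleSeries (cokernel K.arrow) k := by
  haveI := isModularLattice_subobject X
  refine (gc_imageSubobject_pullback (cokernel.π K.arrow) _ _).2 ?_
  change socleSeries X k ≤ (Subobject.pullback (cokernel.π K.arrow)).obj (socleSeries (cokernel K.arrow) k)
  rw [← pullbackOrderIsoIci_apply_coe (cokernel.π K.arrow), socleSeries_def (X := cokernel K.arrow),
    Order.ModularLattice.map_socleSeries (pullbackOrderIsoIci (cokernel.π K.arrow)) k, coe_socleSeries_Ici]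
  exact socleSeries_le_iterate_socleAbove _ k

/-- The radical series of a subobject lies in the radical series: `radᵏ(K) ⊆ radᵏ(X)` (as subobjects of `X`). [cite: Krause2021, Glossary «Socle», «Radical» (PDF p. 21)] -/
theorem map_radicalSeries_le (K : Subobject X) [IsArtinianObject (K : C)] [IsNoetherianObject X] [IsArtinianObject X] (k : ℕ) :
    (Subobject.map K.arrow).obj (radicalSeries (K : C) k) ≤ radicalSeries X k := by
  haveI := isModularLattice_subobject X
  rw [← subobjectOrderIso_apply_coe, radicalSeries_def (X := (K : C)),
    Order.ModularLattice.map_radicalSeries (Subobject.subobjectOrderIso K) k, coe_radicalSeries_Iic]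
  exact iterate_radicalBelow_le_radicalSeries _ k

end Series

/-! ## §2 The Loewy length of subobjects, quotients, extensions and sums -/

section Length

/-- `ht(K) = Λ([⊥, K])`: the height of a subobject is the Loewy length of the lower interval. [cite: Krause2021, Glossary «Socle», «Radical» (PDF p. 21)] [cite: Krause2021, §11.2 (PDF p. 358)] -/
theorem height_subobject_eq (K : Subobject X) [IsNoetherianObject (K : C)] [IsNoetherianObject X] :
    height (K : C) = Order.ModularLattice.socleLength (Set.Iic K) :=
  socleLength_eq_of_orderIso (Subobject.subobjectOrderIso K)

/-- `ℓℓ(X ∕ K) = ll([K, ⊤])`: the Loewy length of a quotient is the radical length of the upper interval. [cite: Krause2021, Glossary «Socle», «Radical» (PDF p. 21)] [cite: Krause2021, §11.2 (PDF p. 358)] -/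
theorem loewyLength_cokernel_eq (K : Subobject X) [IsArtinianObject (cokernel K.arrow)] [IsArtinianObject X] :
    loewyLength (cokernel K.arrow) = Order.ModularLattice.radicalLength (Set.Ici K) :=
  (radicalLength_eq_of_orderIso (pullbackOrderIsoIci (cokernel.π K.arrow))).trans
    (radicalLength_eq_of_orderIso (OrderIso.setCongr _ _ (by rw [kernelSubobject_cokernel_π_arrow])))

/-- `ℓℓ(Q) = ll([Ker q, ⊤])` for an epimorphism `q : X ↠ Q`. [cite: Krause2021, Glossary «Socle», «Radical» (PDF p. 21)] [cite: Krause2021, §11.2 (PDF p. 358)] -/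
theorem loewyLength_eq_of_epi {Q : C} (q : X ⟶ Q) [Epi q] [IsArtinianObject Q] [IsArtinianObject X] :
    loewyLength Q = Order.ModularLattice.radicalLength (Set.Ici (kernelSubobject q)) :=
  radicalLength_eq_of_orderIso (pullbackOrderIsoIci q)

variable [IsArtinianObject X] [IsNoetherianObject X]

/-- **`ht(K) ≤ ht(X)`** for a subobject `K ⊆ X` of an object of finite length. [cite: Krause2021, Glossary «Socle», «Radical» (PDF p. 21)] [cite: Krause2021, §11.2 (PDF p. 358)] -/
theorem height_subobject_le (K : Subobject X) [IsNoetherianObject (K : C)] : height (K : C) ≤ height X := by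
  haveI := isModularLattice_subobject X
  rw [height_subobject_eq]
  exact socleLength_Iic_le K

/-- **`ht(Y) ≤ ht(X)`** for a monomorphism `Y ↪ X`. [cite: Krause2021, Glossary «Socle», «Radical» (PDF p. 21)] [cite: Krause2021, §11.2 (PDF p. 358)] -/
theorem height_le_of_mono {Y : C} (i : Y ⟶ X) [Mono i] [IsNoetherianObject Y] : height Y ≤ height X := by
  haveI : IsNoetherianObject ((Subobject.mk i : Subobject X) : C) := isNoetherianObject_of_mono (Subobject.mk i).arrow
  rw [height_eq_of_iso (Subobject.underlyingIso i).symm]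
  exact height_subobject_le (Subobject.mk i)

/-- **`ℓℓ(Q) ≤ ℓℓ(X)`** for an epimorphism `X ↠ Q`. [cite: Krause2021, Glossary «Socle», «Radical» (PDF p. 21)] [cite: Krause2021, §11.2 (PDF p. 358)] -/
theorem loewyLength_le_of_epi {Q : C} (q : X ⟶ Q) [Epi q] [IsArtinianObject Q] : loewyLength Q ≤ loewyLength X := by
  haveI := isModularLattice_subobject X
  rw [loewyLength_eq_of_epi q]
  exact radicalLength_Ici_le _

/-- `ℓℓ(Y) ≤ ℓℓ(X)` for a monomorphism `Y ↪ X` of objects of finite length. [cite: Krause2021, Glossary «Socle», «Radical» (PDF p. 21)] [cite: Krause2021, §11.2 (PDF p. 358)] -/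
theorem loewyLength_le_of_mono {Y : C} (i : Y ⟶ X) [Mono i] [IsArtinianObject Y] [IsNoetherianObject Y] :
    loewyLength Y ≤ loewyLength X := by
  rw [← height_eq_loewyLength, ← height_eq_loewyLength]; exact height_le_of_mono i

/-- `ht(Q) ≤ ht(X)` for an epimorphism `X ↠ Q` of objects of finite length. [cite: Krause2021, Glossary «Socle», «Radical» (PDF p. 21)] [cite: Krause2021, §11.2 (PDF p. 358)] -/
theorem height_le_of_epi {Q : C} (q : X ⟶ Q) [Epi q] [IsArtinianObject Q] [IsNoetherianObject Q] : height Q ≤ height X := by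
  rw [height_eq_loewyLength, height_eq_loewyLength]; exact loewyLength_le_of_epi q

/-- **Sub-additivity `ℓℓ(X) ≤ ℓℓ(K) + ℓℓ(X ∕ K)`** for a subobject `K` of an object of finite length. [cite: Krause2021, Glossary «Socle», «Radical» (PDF p. 21)] [cite: Krause2021, §11.2 (PDF p. 358)] -/
theorem loewyLength_le_add (K : Subobject X) [IsArtinianObject (K : C)] [IsNoetherianObject (K : C)] [IsArtinianObject (cokernel K.arrow)] :
    loewyLength X ≤ loewyLength (K : C) + loewyLength (cokernel K.arrow) := by
  haveI := isModularLattice_subobject X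
  rw [loewyLength_cokernel_eq, ← height_eq_loewyLength (X := (K : C)), height_subobject_eq, socleLength_eq_radicalLength]
  exact radicalLength_le_add K

/-- **Sub-additivity on short exact sequences: `ℓℓ(X₂) ≤ ℓℓ(X₁) + ℓℓ(X₃)`** for `0 → X₁ → X₂ → X₃ → 0` of objects of finite length. [cite: Krause2021, Glossary «Socle», «Radical» (PDF p. 21)] [cite: Krause2021, §11.2 (PDF p. 358)] -/
theorem loewyLength_le_add_of_shortExact {S : ShortComplex C} (hS : S.ShortExact) [IsArtinianObject S.X₁] [IsNoetherianObject S.X₁]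
    [IsArtinianObject S.X₂] [IsNoetherianObject S.X₂] [IsArtinianObject S.X₃] : loewyLength S.X₂ ≤ loewyLength S.X₁ + loewyLength S.X₃ := by
  haveI := hS.mono_f
  obtain ⟨e⟩ := nonempty_cokernel_mk_arrow_iso hS
  haveI : IsArtinianObject ((Subobject.mk S.f : Subobject S.X₂) : C) := isArtinianObject_of_mono (Subobject.mk S.f).arrow
  haveI : IsNoetherianObject ((Subobject.mk S.f : Subobject S.X₂) : C) := isNoetherianObject_of_mono (Subobject.mk S.f).arrow
  haveI : IsArtinianObject (cokernel (Subobject.mk S.f).arrow) := isArtinianObject_of_epi (cokernel.π _)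
  rw [loewyLength_eq_of_iso (Subobject.underlyingIso S.f).symm, ← loewyLength_eq_of_iso e]
  exact loewyLength_le_add (Subobject.mk S.f)

/-- The two summands of `X ⊞ Y`, as subobjects, have supremum `⊤`. [cite: Krause2021, Glossary «Socle», «Radical» (PDF p. 21)] [cite: Krause2021, §11.2 (PDF p. 358)] -/
theorem mk_inl_sup_mk_inr [HasBinaryBiproducts C] (X Y : C) :
    Subobject.mk (biprod.inl : X ⟶ X ⊞ Y) ⊔ Subobject.mk (biprod.inr : Y ⟶ X ⊞ Y) = ⊤ := by
  have h : (Subobject.mk (biprod.inl : X ⟶ X ⊞ Y) ⊔ Subobject.mk (biprod.inr : Y ⟶ X ⊞ Y)).Factors (𝟙 (X ⊞ Y)) := by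
    rw [← biprod.total]
    exact sup_factors_add (Subobject.factors_of_factors_right _ (Subobject.mk_factors_self _))
      (Subobject.factors_of_factors_right _ (Subobject.mk_factors_self _))
  obtain ⟨g, hg⟩ := (Subobject.factors_iff _ _).1 h
  haveI : IsSplitEpi (Subobject.mk (biprod.inl : X ⟶ X ⊞ Y) ⊔ Subobject.mk (biprod.inr : Y ⟶ X ⊞ Y)).arrow := IsSplitEpi.mk' ⟨g, hg⟩
  haveI := isIso_of_mono_of_isSplitEpi (Subobject.mk (biprod.inl : X ⟶ X ⊞ Y) ⊔ Subobject.mk (biprod.inr : Y ⟶ X ⊞ Y)).arrow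
  exact Subobject.eq_top_of_isIso_arrow _

omit [IsArtinianObject X] [IsNoetherianObject X] in
/-- **`ht(X ⊞ Y) = max (ht X, ht Y)`** for objects of finite length. [cite: Krause2021, Glossary «Socle», «Radical» (PDF p. 21)] [cite: Krause2021, §11.2 (PDF p. 358)] -/
theorem height_biprod [HasBinaryBiproducts C] (X Y : C) [IsArtinianObject (X ⊞ Y)] [IsNoetherianObject (X ⊞ Y)] [IsNoetherianObject X]
    [IsNoetherianObject Y] : height (X ⊞ Y) = max (height X) (height Y) := by
  haveI := isModularLattice_subobject (X ⊞ Y)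
  haveI : IsNoetherianObject ((Subobject.mk (biprod.inl : X ⟶ X ⊞ Y) : Subobject (X ⊞ Y)) : C) :=
    isNoetherianObject_of_mono (Subobject.mk (biprod.inl : X ⟶ X ⊞ Y)).arrow
  haveI : IsNoetherianObject ((Subobject.mk (biprod.inr : Y ⟶ X ⊞ Y) : Subobject (X ⊞ Y)) : C) :=
    isNoetherianObject_of_mono (Subobject.mk (biprod.inr : Y ⟶ X ⊞ Y)).arrow
  rw [height_def, socleLength_eq_max_of_sup_eq_top (mk_inl_sup_mk_inr X Y), ← height_subobject_eq, ← height_subobject_eq,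
    ← height_eq_of_iso (Subobject.underlyingIso (biprod.inl : X ⟶ X ⊞ Y)).symm,
    ← height_eq_of_iso (Subobject.underlyingIso (biprod.inr : Y ⟶ X ⊞ Y)).symm]

omit [IsArtinianObject X] [IsNoetherianObject X] in
/-- **`ℓℓ(X ⊞ Y) = max (ℓℓ X, ℓℓ Y)`** for objects of finite length. [cite: Krause2021, Glossary «Socle», «Radical» (PDF p. 21)] [cite: Krause2021, §11.2 (PDF p. 358)] -/
theorem loewyLength_biprod [HasBinaryBiproducts C] (X Y : C) [IsArtinianObject X] [IsNoetherianObject X] [IsArtinianObject Y]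
    [IsNoetherianObject Y] [IsArtinianObject (X ⊞ Y)] [IsNoetherianObject (X ⊞ Y)] :
    loewyLength (X ⊞ Y) = max (loewyLength X) (loewyLength Y) := by
  rw [← height_eq_loewyLength, ← height_eq_loewyLength, ← height_eq_loewyLength]; exact height_biprod X Y

/-- **`ht(socⁿ X) = n`** for `n ≤ ht(X)`. [cite: Krause2021, Glossary «Socle», «Radical» (PDF p. 21)] [cite: Krause2021, §11.2 (PDF p. 358)] -/
theorem height_socleSeries {n : ℕ} (hn : n ≤ height X) [IsNoetherianObject ((socleSeries X n : Subobject X) : C)] :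
    height (socleSeries X n : C) = n := by
  haveI := isModularLattice_subobject X
  rw [height_subobject_eq, socleSeries_def]
  exact socleLength_Iic_socleSeries hn

/-- **`ℓℓ(X ∕ socⁿ X) = ht(X) − n`.** [cite: Krause2021, Glossary «Socle», «Radical» (PDF p. 21)] [cite: Krause2021, §11.2 (PDF p. 358)] -/
theorem loewyLength_cokernel_socleSeries (n : ℕ) [IsArtinianObject (cokernel (socleSeries X n).arrow)] :
    loewyLength (cokernel (socleSeries X n).arrow) = height X - n := by
  haveI := isModularLattice_subobject X
  rw [loewyLength_cokernel_eq, ← socleLength_eq_radicalLength, socleSeries_def, socleLength_Ici_socleSeries]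
  rfl

end Length

/-! ## §3 The Loewy length is the length of the shortest filtration with semisimple layers -/

section Filtrations

variable [HasFiniteBiproducts C] [IsArtinianObject X] [IsNoetherianObject X]

/-- **A filtration `0 = x₀ ≤ x₁ ≤ ⋯` with semisimple layers `xᵢ₊₁ ∕ xᵢ` (`i < n`) lies termwise under the socle series: `xᵢ ≤ socⁱ(X)`
for `i ≤ n`.** [cite: Krause2021, §11.2 (PDF p. 358)] -/
theorem le_socleSeries_of_isSemisimpleObj_layers (x : ℕ → Subobject X) (hx : Monotone x) (h0 : x 0 = ⊥) {n : ℕ}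
    (hss : ∀ i < n, IsSemisimpleObj (cokernel (Subobject.ofLE (x i) (x (i + 1)) (hx (Nat.le_succ i))))) :
    ∀ i ≤ n, x i ≤ socleSeries X i
  | 0, _ => by rw [h0, socleSeries_zero]
  | i + 1, hi =>
    le_socleSeries_succ_of_isSemisimpleObj (hx (Nat.le_succ i)) (hss i (Nat.lt_of_succ_le hi))
      (le_socleSeries_of_isSemisimpleObj_layers x hx h0 hss i (Nat.le_of_succ_le hi))

/-- Dually such a filtration ending at `xₙ = X` lies termwise over the radical series: `radⁿ⁻ⁱ(X) ≤ xᵢ` for `i ≤ n`. [cite: Krause2021, §11.2 (PDF p. 358)] -/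
theorem radicalSeries_le_of_isSemisimpleObj_layers (x : ℕ → Subobject X) (hx : Monotone x) {n : ℕ} (hn : x n = ⊤)
    (hss : ∀ i < n, IsSemisimpleObj (cokernel (Subobject.ofLE (x i) (x (i + 1)) (hx (Nat.le_succ i))))) :
    ∀ k ≤ n, radicalSeries X k ≤ x (n - k)
  | 0, _ => by rw [Nat.sub_zero, hn, radicalSeries_zero]
  | k + 1, hk => by
    have ih := radicalSeries_le_of_isSemisimpleObj_layers x hx hn hss k (Nat.le_of_succ_le hk)
    obtain ⟨m, hm⟩ : ∃ m, n - k = m + 1 := ⟨n - (k + 1), by omega⟩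
    rw [hm] at ih
    have h := radicalSeries_succ_le_of_isSemisimpleObj (hx (Nat.le_succ m)) (hss m (by omega)) ih
    rwa [show n - (k + 1) = m by omega]

/-- **The height is the length of the shortest filtration of `X` with semisimple layers**: such a filtration `0 = x₀ ≤ ⋯ ≤ xₙ = X` forces
`ht(X) ≤ n` (and the socle series is one of length `ht(X)`, `isSemisimpleObj_socleSeries_succ_cokernel`). [cite: Krause2021, §11.2 (PDF p. 358)] -/
theorem height_le_of_isSemisimpleObj_layers (x : ℕ → Subobject X) (hx : Monotone x) (h0 : x 0 = ⊥) {n : ℕ} (hn : x n = ⊤)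
    (hss : ∀ i < n, IsSemisimpleObj (cokernel (Subobject.ofLE (x i) (x (i + 1)) (hx (Nat.le_succ i))))) : height X ≤ n :=
  socleSeries_eq_top_iff_height_le.1 (top_le_iff.1 (hn ▸ le_socleSeries_of_isSemisimpleObj_layers x hx h0 hss n le_rfl))

/-- The same bound for the Loewy length. [cite: Krause2021, §11.2 (PDF p. 358)] -/
theorem loewyLength_le_of_isSemisimpleObj_layers (x : ℕ → Subobject X) (hx : Monotone x) (h0 : x 0 = ⊥) {n : ℕ} (hn : x n = ⊤)
    (hss : ∀ i < n, IsSemisimpleObj (cokernel (Subobject.ofLE (x i) (x (i + 1)) (hx (Nat.le_succ i))))) : loewyLength X ≤ n :=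
  height_eq_loewyLength (X := X) ▸ height_le_of_isSemisimpleObj_layers x hx h0 hn hss

/-- **`ℓℓ(X) ≤ 2 ↔ rad(X) ⊆ soc(X)`** (`rad²(X) = rad(rad X) = 0` iff `rad(X)` is semisimple iff it lies in the socle). [cite: Krause2021, §11.2 (PDF p. 358)] -/
theorem loewyLength_le_two_iff [IsArtinianObject ((radical X : Subobject X) : C)] [IsNoetherianObject ((radical X : Subobject X) : C)] :
    loewyLength X ≤ 2 ↔ radical X ≤ socle X := by
  haveI : IsArtinianObject ((radicalSeries X 1 : Subobject X) : C) := ‹IsArtinianObject ((radical X : Subobject X) : C)›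
  have h2 : radicalSeries X 2 = (Subobject.map (radical X).arrow).obj (radical (radical X : C)) :=
    radicalSeries_succ_eq_map_radical (X := X) 1
  rw [← radicalSeries_eq_bot_iff_loewyLength_le, le_socle_iff_isSemisimpleObj, ← radical_eq_bot_iff, h2]
  constructor
  · intro h
    apply (gciMapPullback (radical X).arrow).l_injective
    change (Subobject.map (radical X).arrow).obj _ = (Subobject.map (radical X).arrow).obj _
    rw [h, Subobject.map_bot]
  · intro h
    rw [h, Subobject.map_bot]

end Filtrations

end Literature.CategoryTheory.KrullSchmidt
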